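import Literature.MathematicalPhysics.QuantumFieldTheory.Balaban1983to89.TreeLengthDichotomy
import Literature.MathematicalPhysics.QuantumFieldTheory.Balaban1983to89.Step

/-!
# `Balaban1983to89.B16MergeGeometry` — [Balaban1989LargeFieldII] p. 386–387: the GEOMETRY of the merge step of the
induction for (1.80) ("the domains intersect, or touch each other"), KERNEL-CHECKED in the index model of
`…B13ScaleTransfer` / `…TreeLength`; the cost binder `hc` of `Step.Budget.merge_controls` (module `…Step`, Part F2;
cell `STEP.md` §11 row O-F4) DISCHARGED in its connectivity-premised form, and shown NOT inhabited in its unpremised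
form (cell `GAPS.md` rows C-b02g9-3 / G-b02g9-3; unit b2b-balaban-b02, gen 9 — NEW leaf module, imports
`…TreeLengthDichotomy`, `…Step` and modifies nothing)

CITATION HEADER (lean-in-tree rule 2026-08-18).  Source under audit: T. Bałaban, *Large field renormalization. II.
Localization, exponentiation, and bounds for the 𝐑 operation*, Commun. Math. Phys. **122**, 355–392 (1989)
[Balaban1989LargeFieldII] (cell paper B16; held `paper:balaban1989-cmp122-large-field-ii`, journal page = PDF page
+ 354; the passages below were read on the x2 renders `b2b-balaban-ref1/pages/1989-cmp122-large-field-II/…-p032-x2.png`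
(p. 386), `…-p033-x2.png` (p. 387) and `…-p027-x2.png` (p. 381)).  Definition modelled: T. Bałaban, *Renormalization
group approach to lattice gauge field theories. I*, Commun. Math. Phys. **109**, 249–301 (1987) [Balaban1987RG1] (= [I],
cell paper B12), p. 257, verbatim: *"Consider a class of tree graphs contained in X and intersecting all the cubes in X.
A length of a shortest graph in this class, divided by M, is the linear size of X, and is denoted by d_j(X)"* — typed by
the cell as `TreeLength.treeLen` (module `…TreeLength`, conventions (i)–(iii): closed unit cubes, sup metric, infimum,
junk value `0` for an index set without admissible graphs); B16 p. 380 [PDF 26]: *"where d′_j is the linear size defined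
in terms of MR_j-cubes instead of M-cubes"*.  Comparison notion: the Steiner length of [Dimock2013BalabanII] App. E,
typed by the cell as `TreeLength.steinerLen` (no containment condition).  The papers are manuscripts UNDER ADJUDICATION
by the audit cell `pub-balaban`: NOTHING printed in them is asserted here; every `theorem` below is elementary geometry
of the integer grid / of polygonal graphs in `ℝᵈ` and real arithmetic, proved without `sorry` and without new axioms
over the EXISTING definitions `TreeLength.{cube, cubes, carrier, len, lenIn, Admissible, treeLen, SAdmissible,
steinerLen}`, `B13ScaleTransfer.{Pt, Adj, Linked, FaceConnected, block, collar, coarse, closureIdx}`,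
`B16SProfile.{Sop, Siter}`, `TreeLengthDichotomy.Near`, `Step.Budget.{merge, GConn}`, reusing
`TreeLength.{exists_admissible, exists_admissible_len_lt, admissible_join_common, le_lenIn_closedBall, treeLen_singleton,
exists_sAdmissible}`, `B13Geometry236.lenIn_le_len`, `B16SProfile.{Siter_biUnion, faceConnected_Siter, Siter_nonempty,
subset_iterate_collar}`, `TreeLengthDichotomy.treeLen_eq_zero_of_no_admissible` and `Step.Budget.{merge_eq_186,
merge_step, gconn_leaf, gconn_adj, gconn_nonempty}`.

THE PRINTED TEXT.  B16 p. 386 [PDF 32], proof of (1.80) in the second case, verbatim: *"The property (1.76) implies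
(1.84)  Z ⊂ ⋃_n (Z_j^{(n)})′^{~10} ∪ ⋃_i (Z_{j+1}^{(i)})^{~2}. … Define the graph G in the following way: the set of
vertices of G is {Z_j^{(n)}, Z_{j+1}^{(i)}}, and a pair of domains is a line in G if the union of corresponding domains in
(1.84) is a connected domain, i.e., if the corresponding domains intersect, or touch each other. By (1.84) the graph G
is connected. Take a maximal tree graph contained in the graph G. This tree graph has some nonzero number of endpoints,
i.e., vertices which are connected by one line with the rest of the graph. Take one of them, and denote the
corresponding domain in (1.84) by X. Remove the vertex, and the connecting line, from the graph. The obtained graph is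
still a connected tree graph, hence the union of the domains in (1.84) corresponding to the vertices of the obtained
graph is a connected domain. Denote this domain by Y. … By the definitions of X and Y, and by (1.84), we have Z ⊂ X ∪ Y.
… The domain Z is connected, and Z ⊂ X ∪ Y, hence  d′_{j+1}(X) + d′_{j+1}(Y) + 2d ≥ d′_{j+1}(Z),"* — p. 387 [PDF 33],
l. 3–6: *"The domains X, Y intersect, or at least touch each other, hence the intersection of S^{n−j−1}(X), S^{n−j−1}(Y),
for n > j + 1, contains at least a cube of the size 20MR_n. This implies that
d′_n(S^{n−j−1}(Z)) ≤ d′_n(S^{n−j−1}(X)) + d′_n(S^{n−j−1}(Y))."*  (1.76), p. 381 [PDF 27]: *"Z_j ⊂ Z′_{j−1}^{~10} ∪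
⋃_i (Z_j^{(i)})^{~2}"* — an inclusion, so `Z ⊂ X ∪ Y` in (1.84) may be strict.

THE TYPED SIDE (cell module `…Step`, namespace `Step.Budget`, Part F2).  `merge_controls` reduces the induction of
p. 386 to six binders; its cost binder is `hc : ∀ S x, x ∈ S → 2 ≤ S.card → cost S ≤ cost {x} + cost (S.erase x) + D`
— for EVERY member `x` of EVERY subfamily `S`, with NO connectivity premise — whereas its sub-additivity binder `hsub`
carries the premises `Conn S → Conn (S.erase x)` and the induction itself only ever splits off a LEAF `x` of a connected
`S` (`hleaf`).  Cell `STEP.md` §11 row O-F4 lists `hc` as OPEN, "geometric, over b02's regions".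

WHAT IS PROVED HERE (all kernel-checked; `d` arbitrary unless said).
* Part 1 — `Touch a c` (indices differ by ≤ 1 in every coordinate) ↔ the closed unit cubes meet
  (`touch_iff_inter_nonempty`); cubes with a common wall touch; TOUCHING IS FORCED: if `A ∪ B` (`A, B ≠ ∅`) has an
  admissible graph, a cube of `A` touches a cube of `B` (`exists_touch_of_admissible_union`: the connected carrier is
  covered by the closed sets `cubes A`, `cubes B`).
* Part 2 — JOIN THROUGH TOUCHING CUBES at cost ≤ 2 (`admissible_join_touch`), hence
  `d(X ∪ Y) ≤ d(X) + d(Y) + 2` (`treeLen_union_le_of_touch`; `…'` for non-empty face-connected `X, Y`), and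
  `d(X ∪ Y) ≤ d(X) + d(Y) + 1` through a common cube (`treeLen_union_le_of_common`).  This is the printed inequality in
  the UNION READING `Z = X ∪ Y` (constant `2 ≤ 2d`).
* Part 3 — the Steiner size is MONOTONE (`steinerLen_mono`) and sub-additive through touching cubes
  (`steinerLen_union_le_of_touch`), so the printed inference holds VERBATIM for it: `Z ≠ ∅`, `Z ⊆ X ∪ Y`, a cube of `X`
  touching a cube of `Y` ⇒ `ℓ̃(Z) ≤ ℓ̃(X) + ℓ̃(Y) + 2 ≤ … + 2d` (`steinerLen_le_of_subset_union{,_printed}`).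
* Part 4 — families `P : ι → Finset ℤᵈ`: the TOUCH GRAPH (`touchGraph`, the printed graph `G`), the union of a subfamily
  (`fam`), an admissible graph for the union of every tree-connected subfamily (`exists_admissible_fam`), and the
  merge-step geometry `d(⋃ S) ≤ d(P x) + d(⋃ (S ∖ {x})) + 2` for `S`, `S ∖ {x}` tree-connected (`treeLen_fam_le`);
  Steiner form with `S` tree-connected only (`steinerLen_fam_le`).
* Part 5 — `merge_controls_conn`: the induction of `Step.Budget.merge_controls` RE-PROVED with `hc` carrying the
  premises `Conn S → Conn (S.erase x)` (graph form `merge_controls_conn_graph`); and its DISCHARGE over the geometry: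
  with regions having admissible graphs, `Conn := GConn (touchGraph P)` and cost `S ↦ C·d(⋃ S)` (`C ≥ 0`), the binder
  `hc` holds with `D = 2C`, so (1.80)-in-merge-form follows from the ANALYTIC binders `hsingle`, `hP`, `hsub` and the
  budget `E + 2C ≤ q` alone (`merge_controls_treeLen`; Steiner form `merge_controls_steinerLen`).
* Part 6 — p. 387 l. 3–6: one `S`-step makes touching domains share a cube (`coarse_mem_Sop_of_touch`; one layer of the
  ten suffices), all higher iterates share one (`exists_common_Siter`), the iterates distribute over unions
  (`Siter_union`), hence `d(S^{i}(X ∪ Y)) ≤ d(S^{i}X) + d(S^{i}Y) + 1` for `i ≥ 1` (`treeLen_Siter_union_le`) — the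
  printed display has `+ 0`; two graphs meeting a common cube are joined by a connector of length ≤ 1, which the model
  does not improve to 0 (cell DIVERGENCE row D-b02g9.3).
* Part 7 — lower bounds (`sub_one_le_treeLen_of_apart`: two cubes `m ≥ 2` apart in a coordinate force `d ≥ m − 1`),
  separated pieces have no admissible graph (`treeLen_union_eq_zero_of_separated`, junk value 0), and THE UNPREMISED
  `hc` FAILS on the geometry (`OneDim.unpremised_hc_fails`): on the line, for the tree-connected family
  `{0..n}, {n+1}, {n+2..2n+2}` and its NON-LEAF middle piece, `C·d(⋃ S) ≥ C(2n+1)` while the two costs on the right are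
  `0` (a single cube; a disconnected remainder with the junk value) — so for every `C > 0` and every `D` the binder `hc`
  of `Step.Budget.merge_controls` with `cost S := C·d(⋃ S)` is false for some family, whereas the premised binder of
  `merge_controls_conn` is inhabited (Part 5).  The same family refutes the unpremised binder for the Steiner cost
  (far-apart end pieces), not typed here.

WHAT IS NOT CLAIMED.  (a) Nothing about the papers.  (b) The printed inference *"Z connected, Z ⊂ X ∪ Y, hence
d′(X) + d′(Y) + 2d ≥ d′(Z)"* with a STRICT inclusion and the containment-defined `d′` of [I] p. 257 is NOT proved here:
it invokes monotonicity of `d′` under inclusion of connected domains, which the model `treeLen` does not have in general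
(reader-level configuration in cell `GAPS.md` row G-b02g9-3; kernel: only the Steiner size is monotone, Part 3, and the
union case, Part 2).  (c) The horizon bookkeeping of `hsub` (p. 387 l. 7–12, `K ≤ K₂ + n₁ + R_{j+1}`) is not touched;
Part 6 is only its per-term geometric inequality.  (d) `Step.lean` is not modified (one writer: lineage f2); this module
OFFERS `merge_controls_conn` / `merge_controls_treeLen` next to `Step.Budget.merge_controls{,_graph,_index}`.

VALUE: a discharged binder (O-F4 `hc`, premised form) and kernel facts about the cell's MODEL of `d_j`, plus a located
typed-side remark (the unpremised `hc` is uninhabitable by the intended cost); NOT summit progress (rung (B)+1 ≠ infinite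
volume / mass gap / Clay).

v2 (same unit b2b-balaban-b02, gen 9; APPEND-ONLY: every v1 declaration, statement and proof byte-unchanged; imports unchanged)
adds Part 8 — «By (1.84) the graph G is connected» (p. 386, the residual of cell `STEP.md` §11 row O-F5: *"the
CONSTRUCTION of the graph G from (1.84) and «By (1.84) the graph G is connected» (domain-connected ⇒ `GConn`)"*; the
graph is v1's `touchGraph`): `TouchStep` / `TouchConnected` (touch-chain connectedness of a cube family),
`touchConnected_of_faceConnected` (the common-wall chains of [Balaban1987RG1] p. 257 are touch chains),
`touchConnected_of_admissible` (a family carrying an admissible graph is touch-connected, from Part 1's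
`exists_touch_of_admissible_union`), `reachable_induce_touchGraph_of_touch`, and `gconn_touchGraph_of_touchConnected`
(`_of_faceConnected`, `_of_admissible`): a touch-connected `Z` with `Z ⊆ fam P S` ((1.84)) and EVERY domain `P i`, `i ∈ S`,
MEETING `Z`, `S ≠ ∅` ⟹ `Step.Budget.GConn (touchGraph P) S` — the connectedness premise of `Step.Budget.gconn_leaf` /
`merge_controls_graph` and of `merge_controls_treeLen`; `not_gconn_without_meet` records that the premise «every domain
meets Z» cannot be dropped (it is implicit in print: the vertex domains of G are enlargements of the components *"joined
together into the one component"* Z, p. 386).  Cell records for v2: `GAPS.md` C-b02g9-6, `STEP.md` §11 row O-F5 (owner f2: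
status change at their option).
-/

namespace Literature.MathematicalPhysics.QuantumFieldTheory.Balaban1983to89.B16MergeGeometry

open Literature.MathematicalPhysics.QuantumFieldTheory.Balaban1983to89
open Literature.MathematicalPhysics.QuantumFieldTheory.Balaban1983to89.B13ScaleTransfer
open Literature.MathematicalPhysics.QuantumFieldTheory.Balaban1983to89.TreeLength
open Literature.MathematicalPhysics.QuantumFieldTheory.Balaban1983to89.B13Geometry236
open Literature.MathematicalPhysics.QuantumFieldTheory.Balaban1983to89.B16SProfile
open Literature.MathematicalPhysics.QuantumFieldTheory.Balaban1983to89.TreeLengthDichotomy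
open Literature.MathematicalPhysics.QuantumFieldTheory.Balaban1983to89.Step.Budget

noncomputable section

variable {d : ℕ}

/-! ## Part 1. "The corresponding domains intersect, or touch each other" -/

/-- Two closed unit cubes of the grid INTERSECT OR TOUCH: their indices differ by at most one in every coordinate. [folklore] -/
def Touch (a c : Pt d) : Prop := ∀ μ, a μ ≤ c μ + 1 ∧ c μ ≤ a μ + 1

/-- Touching is symmetric. [folklore] -/
theorem Touch.symm {a c : Pt d} (h : Touch a c) : Touch c a := fun μ => ⟨(h μ).2, (h μ).1⟩

/-- A cube touches itself. [folklore] -/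
theorem Touch.refl (a : Pt d) : Touch a a := fun μ => ⟨by omega, by omega⟩

/-- Cubes with a common wall touch. [folklore] -/
theorem Touch.of_adj {a c : Pt d} (h : Adj a c) : Touch a c := by
  obtain ⟨i, h | h⟩ := h
  · intro μ
    rw [h]
    rcases eq_or_ne μ i with rfl | hne
    · simp only [Function.update_self]
      omega
    · simp [Function.update_of_ne hne]
  · intro μ
    rw [h]
    rcases eq_or_ne μ i with rfl | hne
    · simp only [Function.update_self]
      omega
    · simp [Function.update_of_ne hne]

/-- `Near X` (all cubes of `X` pairwise touch, `…TreeLengthDichotomy`) in terms of `Touch`. [folklore] -/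
theorem near_iff_touch (X : Finset (Pt d)) : Near X ↔ ∀ a ∈ X, ∀ c ∈ X, Touch a c :=
  ⟨fun h a ha c hc μ => ⟨h c hc a ha μ, h a ha c hc μ⟩, fun h c₁ h₁ c₂ h₂ μ => (h c₁ h₁ c₂ h₂ μ).2⟩

/-- Touching cubes have a common point (coordinatewise the larger corner). [folklore] -/
theorem Touch.exists_point {a c : Pt d} (h : Touch a c) : ∃ w : RPt d, w ∈ cube a ∧ w ∈ cube c := by
  refine ⟨fun μ => max (a μ : ℝ) (c μ), ?_, ?_⟩
  · rw [mem_cube]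
    intro μ
    have h2 : ((c μ : ℤ) : ℝ) ≤ (a μ : ℝ) + 1 := by exact_mod_cast (h μ).2
    exact ⟨le_max_left _ _, max_le (by linarith) h2⟩
  · rw [mem_cube]
    intro μ
    have h1 : ((a μ : ℤ) : ℝ) ≤ (c μ : ℝ) + 1 := by exact_mod_cast (h μ).1
    exact ⟨le_max_right _ _, max_le h1 (by linarith)⟩

/-- Conversely, cubes with a common point touch. [folklore] -/
theorem touch_of_mem_cube {a c : Pt d} {w : RPt d} (ha : w ∈ cube a) (hc : w ∈ cube c) : Touch a c := by
  intro μ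
  obtain ⟨h1, h2⟩ := mem_cube.1 ha μ
  obtain ⟨h3, h4⟩ := mem_cube.1 hc μ
  constructor
  · have : ((a μ : ℤ) : ℝ) ≤ (c μ : ℝ) + 1 := by linarith
    exact_mod_cast this
  · have : ((c μ : ℤ) : ℝ) ≤ (a μ : ℝ) + 1 := by linarith
    exact_mod_cast this

/-- `Touch a c ↔ □_a ∩ □_c ≠ ∅`. [folklore] -/
theorem touch_iff_inter_nonempty (a c : Pt d) : Touch a c ↔ (cube a ∩ cube c).Nonempty :=
  ⟨fun h => let ⟨w, hwa, hwc⟩ := h.exists_point; ⟨w, hwa, hwc⟩, fun ⟨_, hwa, hwc⟩ => touch_of_mem_cube hwa hwc⟩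

/-- If the unions of cubes of `X` and of `Y` have a common point, a cube of `X` touches a cube of `Y`. [folklore] -/
theorem exists_touch_of_mem_cubes {X Y : Finset (Pt d)} {w : RPt d} (hwX : w ∈ cubes X) (hwY : w ∈ cubes Y) :
    ∃ a ∈ X, ∃ c ∈ Y, Touch a c := by
  obtain ⟨a, ha, hwa⟩ := mem_cubes.1 hwX
  obtain ⟨c, hc, hwc⟩ := mem_cubes.1 hwY
  exact ⟨a, ha, c, hc, touch_of_mem_cube hwa hwc⟩

/-- The union of cubes of `A ∪ B`. [folklore] -/
theorem cubes_union (A B : Finset (Pt d)) : cubes (A ∪ B) = cubes A ∪ cubes B := by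
  ext p
  simp only [mem_cubes, Finset.mem_union, Set.mem_union]
  constructor
  · rintro ⟨x, hx | hx, hp⟩
    · exact Or.inl ⟨x, hx, hp⟩
    · exact Or.inr ⟨x, hx, hp⟩
  · rintro (⟨x, hx, hp⟩ | ⟨x, hx, hp⟩)
    · exact ⟨x, Or.inl hx, hp⟩
    · exact ⟨x, Or.inr hx, hp⟩

/-- TOUCHING IS FORCED: if `A ∪ B` (both non-empty) carries a connected graph meeting all its cubes and contained in
their union, some cube of `A` touches some cube of `B` (the carrier is covered by the two closed sets `cubes A`,
`cubes B` and meets both). [folklore] -/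
theorem exists_touch_of_admissible_union {A B : Finset (Pt d)} (hA : A.Nonempty) (hB : B.Nonempty)
    {T : List (Seg d)} (hT : Admissible (A ∪ B) T) : ∃ a ∈ A, ∃ c ∈ B, Touch a c := by
  by_contra hno
  push Not at hno
  -- closedness of a finite union of closed unit cubes (landed as `B13Ineq232Star.isClosed_cubes` /
  -- `B14.RelTreeLength.isClosed_cube`, not imported here to keep the import cone small)
  have hclosed : ∀ X : Finset (Pt d), IsClosed (cubes X) := fun X =>
    isClosed_biUnion_finset fun x _ => by
      show IsClosed (Set.Icc _ _)
      exact isClosed_Icc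
  have hcover : carrier T ⊆ cubes A ∪ cubes B := by rw [← cubes_union]; exact hT.subset
  have hdisj : carrier T ∩ (cubes A ∩ cubes B) = ∅ := by
    ext w
    simp only [Set.mem_inter_iff, Set.mem_empty_iff_false, iff_false, not_and]
    intro _ hwA hwB
    obtain ⟨a, ha, c, hc, hac⟩ := exists_touch_of_mem_cubes hwA hwB
    exact hno a ha c hc hac
  rcases (isPreconnected_iff_subset_of_disjoint_closed.1 hT.connected.isPreconnected) (cubes A) (cubes B)
      (hclosed A) (hclosed B) hcover hdisj with h | h
  · obtain ⟨b, hb⟩ := hB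
    obtain ⟨r, hr, hrb⟩ := hT.meets b (Finset.mem_union_right _ hb)
    obtain ⟨a, ha, hra⟩ := mem_cubes.1 (h hr)
    exact hno a ha b hb (touch_of_mem_cube hra hrb)
  · obtain ⟨a, ha⟩ := hA
    obtain ⟨r, hr, hra⟩ := hT.meets a (Finset.mem_union_left _ ha)
    obtain ⟨b, hb, hrb⟩ := mem_cubes.1 (h hr)
    exact hno a ha b hb (touch_of_mem_cube hra hrb)

/-! ## Part 2. Joining admissible graphs through touching cubes: `d(X ∪ Y) ≤ d(X) + d(Y) + 2` -/

/-- JOIN THROUGH TOUCHING CUBES: admissible graphs for `A` and for `B`, with a cube `a` of `A` touching a cube `c` of `B`,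
glue to an admissible graph for `A ∪ B` at cost ≤ 2 (a segment inside cube `a` to a common point, then one inside cube
`c`). [folklore] -/
theorem admissible_join_touch {A B : Finset (Pt d)} {TA TB : List (Seg d)} (hA : Admissible A TA)
    (hB : Admissible B TB) {a c : Pt d} (haA : a ∈ A) (hcB : c ∈ B) (hac : Touch a c) :
    ∃ T, Admissible (A ∪ B) T ∧ len T ≤ len TA + len TB + 2 := by
  obtain ⟨p, hpT, hpa⟩ := hA.meets a haA
  obtain ⟨q, hqT, hqc⟩ := hB.meets c hcB
  obtain ⟨w, hwa, hwc⟩ := hac.exists_point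
  refine ⟨TA ++ ((p, w) :: (w, q) :: TB), ⟨?_, ?_, ?_⟩, ?_⟩
  · rw [carrier_append, carrier_cons, carrier_cons]
    have h3 : IsConnected (segment ℝ w q ∪ carrier TB) :=
      IsConnected.union ⟨q, right_mem_segment ℝ w q, hqT⟩
        ((convex_segment w q).isConnected ⟨w, left_mem_segment ℝ w q⟩) hB.connected
    have h2 : IsConnected (segment ℝ p w ∪ (segment ℝ w q ∪ carrier TB)) :=
      IsConnected.union ⟨w, right_mem_segment ℝ p w, Set.mem_union_left _ (left_mem_segment ℝ w q)⟩
        ((convex_segment p w).isConnected ⟨p, left_mem_segment ℝ p w⟩) h3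
    exact IsConnected.union ⟨p, hpT, Set.mem_union_left _ (left_mem_segment ℝ p w)⟩ hA.connected h2
  · rw [carrier_append, carrier_cons, carrier_cons]
    refine Set.union_subset (hA.subset.trans (cubes_mono Finset.subset_union_left))
      (Set.union_subset ?_ (Set.union_subset ?_ (hB.subset.trans (cubes_mono Finset.subset_union_right))))
    · exact ((convex_cube a).segment_subset hpa hwa).trans (cube_subset_cubes (Finset.mem_union_left _ haA))
    · exact ((convex_cube c).segment_subset hwc hqc).trans (cube_subset_cubes (Finset.mem_union_right _ hcB))
  · intro x hx
    rw [carrier_append, carrier_cons, carrier_cons]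
    rcases Finset.mem_union.1 hx with hx | hx
    · obtain ⟨r, hr, hrx⟩ := hA.meets x hx
      exact ⟨r, Set.mem_union_left _ hr, hrx⟩
    · obtain ⟨r, hr, hrx⟩ := hB.meets x hx
      exact ⟨r, Set.mem_union_right _ (Set.mem_union_right _ (Set.mem_union_right _ hr)), hrx⟩
  · rw [len_append, len_cons, len_cons]
    change len TA + (dist p w + (dist w q + len TB)) ≤ len TA + len TB + 2
    linarith [dist_le_one_of_mem_cube hpa hwa, dist_le_one_of_mem_cube hwc hqc]

/-- Hence `X ∪ Y` has an admissible graph if `X` and `Y` have and a cube of `X` touches a cube of `Y`. [folklore] -/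
theorem exists_admissible_union_of_touch {X Y : Finset (Pt d)} (hX : ∃ T, Admissible X T) (hY : ∃ T, Admissible Y T)
    {a c : Pt d} (ha : a ∈ X) (hc : c ∈ Y) (hac : Touch a c) : ∃ T, Admissible (X ∪ Y) T := by
  obtain ⟨TX, hTX⟩ := hX
  obtain ⟨TY, hTY⟩ := hY
  obtain ⟨T, hT, -⟩ := admissible_join_touch hTX hTY ha hc hac
  exact ⟨T, hT⟩

/-- SUBADDITIVITY THROUGH TOUCHING CUBES for the linear size: `d(X ∪ Y) ≤ d(X) + d(Y) + 2` whenever `X`, `Y` have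
admissible graphs and a cube of `X` touches a cube of `Y` (infimum form of `admissible_join_touch`). [folklore] -/
theorem treeLen_union_le_of_touch {X Y : Finset (Pt d)} (hX : ∃ T, Admissible X T) (hY : ∃ T, Admissible Y T)
    {a c : Pt d} (ha : a ∈ X) (hc : c ∈ Y) (hac : Touch a c) :
    treeLen (X ∪ Y) ≤ treeLen X + treeLen Y + 2 := by
  refine le_of_forall_pos_le_add fun ε hε => ?_
  obtain ⟨TX, hTX, hlX⟩ := exists_admissible_len_lt hX (half_pos hε)
  obtain ⟨TY, hTY, hlY⟩ := exists_admissible_len_lt hY (half_pos hε)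
  obtain ⟨T, hT, hlen⟩ := admissible_join_touch hTX hTY ha hc hac
  have := treeLen_le_len hT
  linarith

/-- The same for non-empty face-connected `X`, `Y` (which have admissible graphs, `TreeLength.exists_admissible`). [folklore] -/
theorem treeLen_union_le_of_touch' {X Y : Finset (Pt d)} (hX : X.Nonempty) (hXc : FaceConnected X)
    (hY : Y.Nonempty) (hYc : FaceConnected Y) {a c : Pt d} (ha : a ∈ X) (hc : c ∈ Y) (hac : Touch a c) :
    treeLen (X ∪ Y) ≤ treeLen X + treeLen Y + 2 := by
  obtain ⟨TX, hTX, -⟩ := exists_admissible hX hXc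
  obtain ⟨TY, hTY, -⟩ := exists_admissible hY hYc
  exact treeLen_union_le_of_touch ⟨TX, hTX⟩ ⟨TY, hTY⟩ ha hc hac

/-- SUBADDITIVITY THROUGH A COMMON CUBE: `d(X ∪ Y) ≤ d(X) + d(Y) + 1` when `X` and `Y` share a cube (infimum form of
`TreeLength.admissible_join_common`). [folklore] -/
theorem treeLen_union_le_of_common {X Y : Finset (Pt d)} (hX : ∃ T, Admissible X T) (hY : ∃ T, Admissible Y T)
    {c : Pt d} (hcX : c ∈ X) (hcY : c ∈ Y) : treeLen (X ∪ Y) ≤ treeLen X + treeLen Y + 1 := by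
  refine le_of_forall_pos_le_add fun ε hε => ?_
  obtain ⟨TX, hTX, hlX⟩ := exists_admissible_len_lt hX (half_pos hε)
  obtain ⟨TY, hTY, hlY⟩ := exists_admissible_len_lt hY (half_pos hε)
  obtain ⟨T, hT, hlen⟩ := admissible_join_common hTY hTX hcY hcX
  have := treeLen_le_len hT
  linarith

/-! ## Part 3. The Steiner size: monotone, and subadditive through touching cubes — the printed inference verbatim -/

/-- A Steiner-admissible graph for `W` is one for every `Z ⊆ W` (no containment condition). [folklore] -/
theorem sAdmissible_anti {Z W : Finset (Pt d)} (hZW : Z ⊆ W) {T : List (Seg d)} (hT : SAdmissible W T) :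
    SAdmissible Z T :=
  ⟨hT.connected, fun y hy => hT.meets y (hZW hy)⟩

/-- THE STEINER SIZE IS MONOTONE: `Z ⊆ W`, `Z ≠ ∅` ⇒ `ℓ̃(Z) ≤ ℓ̃(W)`. [folklore] -/
theorem steinerLen_mono {Z W : Finset (Pt d)} (hZW : Z ⊆ W) (hZ : Z.Nonempty) : steinerLen Z ≤ steinerLen W := by
  obtain ⟨T₀, hT₀⟩ := exists_sAdmissible (hZ.mono hZW)
  change steinerLen Z ≤ sInf (slengths W)
  refine le_csInf ⟨len T₀, T₀, hT₀, rfl⟩ ?_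
  rintro _ ⟨T, hT, rfl⟩
  exact steinerLen_le_len (sAdmissible_anti hZW hT)

/-- Near-optimal Steiner-admissible graphs. [folklore] -/
theorem exists_sAdmissible_len_lt {Y : Finset (Pt d)} (hY : Y.Nonempty) {ε : ℝ} (hε : 0 < ε) :
    ∃ T, SAdmissible Y T ∧ len T < steinerLen Y + ε := by
  obtain ⟨T₀, hT₀⟩ := exists_sAdmissible hY
  obtain ⟨ℓ, ⟨T, hT, rfl⟩, hlt⟩ :=
    exists_lt_of_csInf_lt (s := slengths Y) ⟨len T₀, T₀, hT₀, rfl⟩ (lt_add_of_pos_right _ hε)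
  exact ⟨T, hT, hlt⟩

/-- Join of Steiner-admissible graphs through touching cubes, cost ≤ 2. [folklore] -/
theorem sAdmissible_join_touch {A B : Finset (Pt d)} {TA TB : List (Seg d)} (hA : SAdmissible A TA)
    (hB : SAdmissible B TB) {a c : Pt d} (haA : a ∈ A) (hcB : c ∈ B) (hac : Touch a c) :
    ∃ T, SAdmissible (A ∪ B) T ∧ len T ≤ len TA + len TB + 2 := by
  obtain ⟨p, hpT, hpa⟩ := hA.meets a haA
  obtain ⟨q, hqT, hqc⟩ := hB.meets c hcB
  obtain ⟨w, hwa, hwc⟩ := hac.exists_point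
  refine ⟨TA ++ ((p, w) :: (w, q) :: TB), ⟨?_, ?_⟩, ?_⟩
  · rw [carrier_append, carrier_cons, carrier_cons]
    have h3 : IsConnected (segment ℝ w q ∪ carrier TB) :=
      IsConnected.union ⟨q, right_mem_segment ℝ w q, hqT⟩
        ((convex_segment w q).isConnected ⟨w, left_mem_segment ℝ w q⟩) hB.connected
    have h2 : IsConnected (segment ℝ p w ∪ (segment ℝ w q ∪ carrier TB)) :=
      IsConnected.union ⟨w, right_mem_segment ℝ p w, Set.mem_union_left _ (left_mem_segment ℝ w q)⟩
        ((convex_segment p w).isConnected ⟨p, left_mem_segment ℝ p w⟩) h3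
    exact IsConnected.union ⟨p, hpT, Set.mem_union_left _ (left_mem_segment ℝ p w)⟩ hA.connected h2
  · intro x hx
    rw [carrier_append, carrier_cons, carrier_cons]
    rcases Finset.mem_union.1 hx with hx | hx
    · obtain ⟨r, hr, hrx⟩ := hA.meets x hx
      exact ⟨r, Set.mem_union_left _ hr, hrx⟩
    · obtain ⟨r, hr, hrx⟩ := hB.meets x hx
      exact ⟨r, Set.mem_union_right _ (Set.mem_union_right _ (Set.mem_union_right _ hr)), hrx⟩
  · rw [len_append, len_cons, len_cons]
    change len TA + (dist p w + (dist w q + len TB)) ≤ len TA + len TB + 2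
    linarith [dist_le_one_of_mem_cube hpa hwa, dist_le_one_of_mem_cube hwc hqc]

/-- `ℓ̃(X ∪ Y) ≤ ℓ̃(X) + ℓ̃(Y) + 2` when a cube of `X` touches a cube of `Y` (`X`, `Y` non-empty; no connectedness
needed). [folklore] -/
theorem steinerLen_union_le_of_touch {X Y : Finset (Pt d)} (hX : X.Nonempty) (hY : Y.Nonempty) {a c : Pt d}
    (ha : a ∈ X) (hc : c ∈ Y) (hac : Touch a c) : steinerLen (X ∪ Y) ≤ steinerLen X + steinerLen Y + 2 := by
  refine le_of_forall_pos_le_add fun ε hε => ?_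
  obtain ⟨TX, hTX, hlX⟩ := exists_sAdmissible_len_lt hX (half_pos hε)
  obtain ⟨TY, hTY, hlY⟩ := exists_sAdmissible_len_lt hY (half_pos hε)
  obtain ⟨T, hT, hlen⟩ := sAdmissible_join_touch hTX hTY ha hc hac
  have := steinerLen_le_len hT
  linarith

/-- THE PRINTED INFERENCE, VERBATIM, FOR THE STEINER SIZE: *"Z ⊂ X ∪ Y, hence d′(X) + d′(Y) + 2d ≥ d′(Z)"* — for
non-empty `Z ⊆ X ∪ Y` with a cube of `X` touching a cube of `Y`: `ℓ̃(Z) ≤ ℓ̃(X) + ℓ̃(Y) + 2` (monotonicity + join). [folklore] -/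
theorem steinerLen_le_of_subset_union {Z X Y : Finset (Pt d)} (hZ : Z.Nonempty) (hZXY : Z ⊆ X ∪ Y)
    (hX : X.Nonempty) (hY : Y.Nonempty) {a c : Pt d} (ha : a ∈ X) (hc : c ∈ Y) (hac : Touch a c) :
    steinerLen Z ≤ steinerLen X + steinerLen Y + 2 :=
  (steinerLen_mono hZXY hZ).trans (steinerLen_union_le_of_touch hX hY ha hc hac)

/-- … and with the printed constant `2d` (`d ≥ 1`). [folklore] -/
theorem steinerLen_le_of_subset_union_printed (hd : 1 ≤ d) {Z X Y : Finset (Pt d)} (hZ : Z.Nonempty)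
    (hZXY : Z ⊆ X ∪ Y) (hX : X.Nonempty) (hY : Y.Nonempty) {a c : Pt d} (ha : a ∈ X) (hc : c ∈ Y)
    (hac : Touch a c) : steinerLen Z ≤ steinerLen X + steinerLen Y + 2 * d := by
  have h1 : (1 : ℝ) ≤ d := by exact_mod_cast hd
  linarith [steinerLen_le_of_subset_union hZ hZXY hX hY ha hc hac]

/-! ## Part 4. Families of domains: the touch graph, the union of a subfamily, tree-connected subfamilies -/

section Families

variable {ι : Type*}

/-- THE TOUCH GRAPH of a family of domains `P : ι → Finset ℤᵈ`: `i ~ j` iff a cube of `P i` touches a cube of `P j`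
(p. 386: *"a pair of domains is a line in G if … the corresponding domains intersect, or touch each other"*).
[cite: Balaban1989LargeFieldII, p.386 (merge step, (1.84)-(1.87))] -/
def touchGraph (P : ι → Finset (Pt d)) : SimpleGraph ι where
  Adj i j := i ≠ j ∧ ∃ a ∈ P i, ∃ c ∈ P j, Touch a c
  symm := ⟨by
    rintro i j ⟨hne, a, ha, c, hc, hac⟩
    exact ⟨hne.symm, c, hc, a, ha, hac.symm⟩⟩
  loopless := ⟨fun _ h => h.1 rfl⟩

/-- Adjacency in the touch graph, unfolded. [folklore] -/
theorem touchGraph_adj (P : ι → Finset (Pt d)) (i j : ι) :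
    (touchGraph P).Adj i j ↔ i ≠ j ∧ ∃ a ∈ P i, ∃ c ∈ P j, Touch a c := Iff.rfl

/-- The union of the domains of a subfamily `S`. [folklore] -/
def fam (P : ι → Finset (Pt d)) (S : Finset ι) : Finset (Pt d) := S.biUnion P

/-- Membership in the union of a subfamily. [folklore] -/
theorem mem_fam {P : ι → Finset (Pt d)} {S : Finset ι} {y : Pt d} : y ∈ fam P S ↔ ∃ i ∈ S, y ∈ P i :=
  Finset.mem_biUnion

/-- A member domain lies in the union. [folklore] -/
theorem subset_fam (P : ι → Finset (Pt d)) {S : Finset ι} {i : ι} (hi : i ∈ S) : P i ⊆ fam P S :=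
  Finset.subset_biUnion_of_mem P hi

/-- The union of a one-member subfamily. [folklore] -/
@[simp] theorem fam_singleton (P : ι → Finset (Pt d)) (x : ι) : fam P {x} = P x := by
  unfold fam
  exact Finset.singleton_biUnion

/-- Splitting off one member: `⋃ S = P x ∪ ⋃ (S ∖ {x})`. [folklore] -/
theorem fam_eq_union_erase [DecidableEq ι] (P : ι → Finset (Pt d)) {S : Finset ι} {x : ι} (hx : x ∈ S) :
    fam P S = P x ∪ fam P (S.erase x) := by
  unfold fam
  conv_lhs => rw [← Finset.insert_erase hx]
  rw [Finset.biUnion_insert]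

/-- The union of a non-empty subfamily of non-empty domains is non-empty. [folklore] -/
theorem fam_nonempty {P : ι → Finset (Pt d)} (hP : ∀ i, (P i).Nonempty) {S : Finset ι} (hS : S.Nonempty) :
    (fam P S).Nonempty := by
  obtain ⟨i, hi⟩ := hS
  obtain ⟨y, hy⟩ := hP i
  exact ⟨y, subset_fam P hi hy⟩

/-- A TREE-CONNECTED SUBFAMILY OF DOMAINS WITH ADMISSIBLE GRAPHS HAS AN ADMISSIBLE GRAPH FOR ITS UNION (induction along
leaves of the touch graph, joining through touching cubes). [folklore] -/
theorem exists_admissible_fam [DecidableEq ι] {P : ι → Finset (Pt d)} (hP : ∀ i, ∃ T, Admissible (P i) T) :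
    ∀ S : Finset ι, GConn (touchGraph P) S → ∃ T, Admissible (fam P S) T := by
  intro S
  induction S using Finset.strongInduction with
  | H S ih =>
    intro hS
    by_cases h2 : 2 ≤ S.card
    · obtain ⟨x, hx, hY⟩ := gconn_leaf (touchGraph P) S hS h2
      obtain ⟨y, hy, hadj⟩ := gconn_adj (touchGraph P) S hS h2 hx
      obtain ⟨-, a, ha, c, hc, hac⟩ := (touchGraph_adj P x y).1 hadj
      rw [fam_eq_union_erase P hx]
      exact exists_admissible_union_of_touch (hP x) (ih (S.erase x) (Finset.erase_ssubset hx) hY) ha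
        (subset_fam P hy hc) hac
    · have hne := gconn_nonempty (touchGraph P) S hS
      have hcard : S.card = 1 := by have := Finset.card_pos.mpr hne; omega
      obtain ⟨y, rfl⟩ := Finset.card_eq_one.mp hcard
      rw [fam_singleton]
      exact hP y

/-- THE MERGE-STEP GEOMETRY, LINEAR SIZE (union reading): for a tree-connected subfamily `S` of domains with admissible
graphs, a member `x` whose removal keeps `S ∖ {x}` tree-connected, `d(⋃ S) ≤ d(P x) + d(⋃ (S ∖ {x})) + 2`. [cite: Balaban1989LargeFieldII, p.386 (merge step, (1.84)-(1.87))] -/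
theorem treeLen_fam_le [DecidableEq ι] {P : ι → Finset (Pt d)} (hP : ∀ i, ∃ T, Admissible (P i) T) {S : Finset ι}
    {x : ι} (hx : x ∈ S) (h2 : 2 ≤ S.card) (hS : GConn (touchGraph P) S) (hY : GConn (touchGraph P) (S.erase x)) :
    treeLen (fam P S) ≤ treeLen (P x) + treeLen (fam P (S.erase x)) + 2 := by
  obtain ⟨y, hy, hadj⟩ := gconn_adj (touchGraph P) S hS h2 hx
  obtain ⟨-, a, ha, c, hc, hac⟩ := (touchGraph_adj P x y).1 hadj
  rw [fam_eq_union_erase P hx]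
  exact treeLen_union_le_of_touch (hP x) (exists_admissible_fam hP _ hY) ha (subset_fam P hy hc) hac

/-- THE MERGE-STEP GEOMETRY, STEINER SIZE: for a tree-connected subfamily `S` of non-empty domains and any member `x`,
`ℓ̃(⋃ S) ≤ ℓ̃(P x) + ℓ̃(⋃ (S ∖ {x})) + 2` (no connectedness of the domains or of `S ∖ {x}` needed). [cite: Balaban1989LargeFieldII, p.386 (merge step, (1.84)-(1.87))] -/
theorem steinerLen_fam_le [DecidableEq ι] {P : ι → Finset (Pt d)} (hP : ∀ i, (P i).Nonempty) {S : Finset ι}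
    {x : ι} (hx : x ∈ S) (h2 : 2 ≤ S.card) (hS : GConn (touchGraph P) S) :
    steinerLen (fam P S) ≤ steinerLen (P x) + steinerLen (fam P (S.erase x)) + 2 := by
  obtain ⟨y, hy, hadj⟩ := gconn_adj (touchGraph P) S hS h2 hx
  obtain ⟨-, a, ha, c, hc, hac⟩ := (touchGraph_adj P x y).1 hadj
  rw [fam_eq_union_erase P hx]
  exact steinerLen_union_le_of_touch (hP x) (fam_nonempty hP ⟨y, hy⟩) ha (subset_fam P hy hc) hac

end Families

/-! ## Part 5. The merge induction with the connectivity premises on `hc`, and its discharge over the geometry -/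

section Merge

variable {ι : Type*} [DecidableEq ι]

/-- `Step.Budget.merge_controls` WITH THE CONNECTIVITY PREMISES ON `hc`: the same induction over tree-connected
subfamilies (remove a leaf `x`, merge `{x}` with `S ∖ {x}` by (1.86), budget `E + D ≤ q`), where the cost inequality
`hc` is required only for `S` and `S ∖ {x}` connected — the premises the induction has in scope (they are the premises
`Step.Budget.merge_controls` already grants to `hsub`).  PROVED. [cite: Balaban1989LargeFieldII, p.386 (merge step, (1.84)-(1.87))] -/
theorem merge_controls_conn (contrib : ι → ℝ) (cost P rhs : Finset ι → ℝ) (Conn : Finset ι → Prop) (q E D : ℝ)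
    (hleaf : ∀ S, Conn S → 2 ≤ S.card → ∃ x ∈ S, Conn (S.erase x))
    (hsingle : ∀ x, rhs {x} ≤ merge contrib {x} (cost {x}) (P {x}))
    (hP : ∀ S x, x ∈ S → 2 ≤ S.card → q ≤ P {x} + P (S.erase x) - P S)
    (hc : ∀ S x, x ∈ S → 2 ≤ S.card → Conn S → Conn (S.erase x) → cost S ≤ cost {x} + cost (S.erase x) + D)
    (hsub : ∀ S x, x ∈ S → 2 ≤ S.card → Conn S → Conn (S.erase x) → rhs S ≤ rhs {x} + rhs (S.erase x) + E)
    (hbudget : E + D ≤ q) :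
    ∀ S, Conn S → S.Nonempty → rhs S ≤ merge contrib S (cost S) (P S) := by
  intro S
  induction S using Finset.strongInduction with
  | H S ih =>
    intro hconn hne
    by_cases h2 : 2 ≤ S.card
    · obtain ⟨x, hx, hconnY⟩ := hleaf S hconn h2
      have hYne : (S.erase x).Nonempty := by
        rw [← Finset.card_pos, Finset.card_erase_of_mem hx]
        omega
      have ihY := ih (S.erase x) (Finset.erase_ssubset hx) hconnY hYne
      exact merge_step _ _ _ _ _ _ _ _ _ _ _ _ q E D
        (merge_eq_186 contrib S x hx (cost S) (P S) (cost {x}) (P {x}) (cost (S.erase x)) (P (S.erase x)))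
        (hP S x hx h2) (hc S x hx h2 hconn hconnY) (hsub S x hx h2 hconn hconnY) (hsingle x) ihY hbudget
    · have hcard : S.card = 1 := by have := Finset.card_pos.mpr hne; omega
      obtain ⟨y, rfl⟩ := Finset.card_eq_one.mp hcard
      exact hsingle y

/-- Graph form: `Conn := GConn G` for a symmetric "touch" relation `G` on the regions (leaf removal by
`Step.Budget.gconn_leaf`). [cite: Balaban1989LargeFieldII, p.386 (merge step, (1.84)-(1.87))] -/
theorem merge_controls_conn_graph (G : SimpleGraph ι) (contrib : ι → ℝ) (cost P rhs : Finset ι → ℝ) (q E D : ℝ)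
    (hsingle : ∀ x, rhs {x} ≤ merge contrib {x} (cost {x}) (P {x}))
    (hP : ∀ S x, x ∈ S → 2 ≤ S.card → q ≤ P {x} + P (S.erase x) - P S)
    (hc : ∀ S x, x ∈ S → 2 ≤ S.card → GConn G S → GConn G (S.erase x) → cost S ≤ cost {x} + cost (S.erase x) + D)
    (hsub : ∀ S x, x ∈ S → 2 ≤ S.card → GConn G S → GConn G (S.erase x) → rhs S ≤ rhs {x} + rhs (S.erase x) + E)
    (hbudget : E + D ≤ q) :
    ∀ S, GConn G S → rhs S ≤ merge contrib S (cost S) (P S) := fun S hS =>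
  merge_controls_conn contrib cost P rhs (GConn G) q E D (fun T hT h2 => gconn_leaf G T hT h2) hsingle hP hc hsub
    hbudget S hS (gconn_nonempty G S hS)

/-- DISCHARGE OF `hc` OVER THE GEOMETRY, LINEAR SIZE (union reading): regions `P i ⊆ ℤᵈ` with admissible graphs,
touch graph as the tree relation, cost of a subfamily `:= C · d(⋃ S)` (`C ≥ 0`, the printed `O(1) M^d R_{j+1}^{d+1}`);
then `hc` holds with `D = 2C` by `treeLen_fam_le`, and the merge induction concludes from the remaining ANALYTIC
binders `hsingle`, `hP`, `hsub` and the budget `E + 2C ≤ q`. [cite: Balaban1989LargeFieldII, p.386 (merge step, (1.84)-(1.87))] -/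
theorem merge_controls_treeLen (P : ι → Finset (Pt d)) (hadm : ∀ i, ∃ T, Admissible (P i) T) (contrib : ι → ℝ)
    (Pf rhs : Finset ι → ℝ) (q E C : ℝ) (hC : 0 ≤ C)
    (hsingle : ∀ x, rhs {x} ≤ merge contrib {x} (C * treeLen (fam P {x})) (Pf {x}))
    (hP : ∀ S x, x ∈ S → 2 ≤ S.card → q ≤ Pf {x} + Pf (S.erase x) - Pf S)
    (hsub : ∀ S x, x ∈ S → 2 ≤ S.card → GConn (touchGraph P) S → GConn (touchGraph P) (S.erase x) →
      rhs S ≤ rhs {x} + rhs (S.erase x) + E)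
    (hbudget : E + 2 * C ≤ q) :
    ∀ S, GConn (touchGraph P) S → rhs S ≤ merge contrib S (C * treeLen (fam P S)) (Pf S) := by
  refine merge_controls_conn_graph (touchGraph P) contrib (fun S => C * treeLen (fam P S)) Pf rhs q E (2 * C)
    hsingle hP ?_ hsub hbudget
  intro S x hx h2 hS hY
  have h := treeLen_fam_le hadm hx h2 hS hY
  calc C * treeLen (fam P S) ≤ C * (treeLen (P x) + treeLen (fam P (S.erase x)) + 2) :=
        mul_le_mul_of_nonneg_left h hC
    _ = C * treeLen (fam P {x}) + C * treeLen (fam P (S.erase x)) + 2 * C := by rw [fam_singleton]; ring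

/-- DISCHARGE OF `hc` OVER THE GEOMETRY, STEINER SIZE: the same with cost `:= C · ℓ̃(⋃ S)` for non-empty regions (no
connectedness of the regions needed), by `steinerLen_fam_le`. [cite: Balaban1989LargeFieldII, p.386 (merge step, (1.84)-(1.87))] -/
theorem merge_controls_steinerLen (P : ι → Finset (Pt d)) (hne : ∀ i, (P i).Nonempty) (contrib : ι → ℝ)
    (Pf rhs : Finset ι → ℝ) (q E C : ℝ) (hC : 0 ≤ C)
    (hsingle : ∀ x, rhs {x} ≤ merge contrib {x} (C * steinerLen (fam P {x})) (Pf {x}))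
    (hP : ∀ S x, x ∈ S → 2 ≤ S.card → q ≤ Pf {x} + Pf (S.erase x) - Pf S)
    (hsub : ∀ S x, x ∈ S → 2 ≤ S.card → GConn (touchGraph P) S → GConn (touchGraph P) (S.erase x) →
      rhs S ≤ rhs {x} + rhs (S.erase x) + E)
    (hbudget : E + 2 * C ≤ q) :
    ∀ S, GConn (touchGraph P) S → rhs S ≤ merge contrib S (C * steinerLen (fam P S)) (Pf S) := by
  refine merge_controls_conn_graph (touchGraph P) contrib (fun S => C * steinerLen (fam P S)) Pf rhs q E (2 * C)
    hsingle hP ?_ hsub hbudget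
  intro S x hx h2 hS _
  have h := steinerLen_fam_le hne hx h2 hS
  calc C * steinerLen (fam P S) ≤ C * (steinerLen (P x) + steinerLen (fam P (S.erase x)) + 2) :=
        mul_le_mul_of_nonneg_left h hC
    _ = C * steinerLen (fam P {x}) + C * steinerLen (fam P (S.erase x)) + 2 * C := by rw [fam_singleton]; ring

end Merge

/-! ## Part 6. The `S`-iterates of touching domains share a cube: `d′_n(S^m(X ∪ Y)) ≤ d′_n(S^m X) + d′_n(S^m Y) + 1` -/

section Iterates

/-- Coarse-graining preserves touching (`q ≥ 1`): `|a_μ − c_μ| ≤ 1 ⇒ |⌊a_μ/q⌋ − ⌊c_μ/q⌋| ≤ 1`. [folklore] -/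
theorem touch_coarse {q : ℕ} (hq : 0 < q) {a c : Pt d} (h : Touch a c) : Touch (coarse q a) (coarse q c) := by
  have hq' : (0 : ℤ) < q := by exact_mod_cast hq
  have hq0 : (q : ℤ) ≠ 0 := ne_of_gt hq'
  have key : ∀ u v : ℤ, u ≤ v + 1 → u / (q : ℤ) ≤ v / (q : ℤ) + 1 := by
    intro u v huv
    have h1 : u / (q : ℤ) ≤ (v + 1 * q) / (q : ℤ) := Int.ediv_le_ediv hq' (by linarith)
    rwa [Int.add_mul_ediv_right _ _ hq0] at h1
  intro μ
  exact ⟨key _ _ (h μ).1, key _ _ (h μ).2⟩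

/-- ONE `S`-STEP MAKES TOUCHING DOMAINS OVERLAP: if a cube `a ∈ X` touches a cube `c ∈ Y`, the coarse image of `c` is a
cube of both `S_q(X)` and `S_q(Y)` (`S_q = ` ten layers around the `q`-closure, `B16SProfile.Sop`; one layer suffices).
p. 387, l. 3–5: *"The domains X, Y intersect, or at least touch each other, hence the intersection of S^{n−j−1}(X),
S^{n−j−1}(Y), for n > j+1, contains at least a cube"*. [cite: Balaban1989LargeFieldII, p.387 (lines 3-6)] -/
theorem coarse_mem_Sop_of_touch {q : ℕ} (hq : 0 < q) {X Y : Finset (Pt d)} {a c : Pt d} (ha : a ∈ X) (hc : c ∈ Y)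
    (hac : Touch a c) : coarse q c ∈ Sop q X ∧ coarse q c ∈ Sop q Y := by
  constructor
  · have hblock : coarse q c ∈ B13ScaleTransfer.block (coarse q a) := by
      rw [mem_block]
      intro i
      obtain ⟨h1, h2⟩ := touch_coarse hq hac i
      constructor <;> omega
    have h1 : coarse q c ∈ collar (closureIdx q X) :=
      mem_collar.2 ⟨coarse q a, Finset.mem_image_of_mem _ ha, hblock⟩
    change coarse q c ∈ collar^[9 + 1] (closureIdx q X)
    rw [Function.iterate_succ_apply]
    exact subset_iterate_collar 9 _ h1
  · exact subset_iterate_collar 10 _ (Finset.mem_image_of_mem _ hc)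

/-- Hence ALL HIGHER ITERATES SHARE A CUBE: for `i ≥ 1`, `S^{i}(X) ∩ S^{i}(Y) ≠ ∅` (positive ratios). [cite: Balaban1989LargeFieldII, p.387 (lines 3-6)] -/
theorem exists_common_Siter {q : ℕ → ℕ} (hq : ∀ l, 0 < q l) {X Y : Finset (Pt d)} {a c : Pt d} (ha : a ∈ X)
    (hc : c ∈ Y) (hac : Touch a c) {i : ℕ} (hi : 1 ≤ i) : ∃ e, e ∈ Siter q i X ∧ e ∈ Siter q i Y := by
  induction i, hi using Nat.le_induction with
  | base => exact ⟨coarse (q 0) c, coarse_mem_Sop_of_touch (hq 0) ha hc hac⟩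
  | succ i _ ih =>
    obtain ⟨e, heX, heY⟩ := ih
    exact ⟨coarse (q i) e, coarse_mem_Sop_of_touch (hq i) heX heY (Touch.refl e)⟩

/-- The iterates distribute over binary unions. [cite: Balaban1989LargeFieldII, p.384 (display after (1.80))] -/
theorem Siter_union (q : ℕ → ℕ) (i : ℕ) (X Y : Finset (Pt d)) :
    Siter q i (X ∪ Y) = Siter q i X ∪ Siter q i Y := by
  have h : X ∪ Y = ({X, Y} : Finset (Finset (Pt d))).biUnion id := by simp
  rw [h, Siter_biUnion]
  simp

/-- THE DISPLAY OF p. 387, l. 6, in the form the geometry gives: for non-empty face-connected `X`, `Y` with a touching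
pair of cubes and `i ≥ 1`, `d(S^{i}(X ∪ Y)) ≤ d(S^{i} X) + d(S^{i} Y) + 1` (printed with `+ 0`: *"This implies that
d′_n(S^{n−j−1}(Z)) ≤ d′_n(S^{n−j−1}(X)) + d′_n(S^{n−j−1}(Y))"*; two graphs meeting a common cube need a connector of
length ≤ 1, not 0 — cell DIVERGENCE row). [cite: Balaban1989LargeFieldII, p.387 (lines 3-6)] -/
theorem treeLen_Siter_union_le {q : ℕ → ℕ} (hq : ∀ l, 0 < q l) {X Y : Finset (Pt d)} (hX : X.Nonempty)
    (hXc : FaceConnected X) (hY : Y.Nonempty) (hYc : FaceConnected Y) {a c : Pt d} (ha : a ∈ X) (hc : c ∈ Y)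
    (hac : Touch a c) {i : ℕ} (hi : 1 ≤ i) :
    treeLen (Siter q i (X ∪ Y)) ≤ treeLen (Siter q i X) + treeLen (Siter q i Y) + 1 := by
  obtain ⟨e, heX, heY⟩ := exists_common_Siter hq ha hc hac hi
  obtain ⟨TX, hTX, -⟩ := exists_admissible (Siter_nonempty q hX i) (faceConnected_Siter hq hXc i)
  obtain ⟨TY, hTY, -⟩ := exists_admissible (Siter_nonempty q hY i) (faceConnected_Siter hq hYc i)
  rw [Siter_union]
  exact treeLen_union_le_of_common ⟨TX, hTX⟩ ⟨TY, hTY⟩ heX heY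

/-- … and at `i = 0` (no iterate) the bound is `+ 2` (`treeLen_union_le_of_touch'`). [cite: Balaban1989LargeFieldII, p.386 (merge step, (1.84)-(1.87))] -/
theorem treeLen_Siter_zero_union_le (q : ℕ → ℕ) {X Y : Finset (Pt d)} (hX : X.Nonempty) (hXc : FaceConnected X)
    (hY : Y.Nonempty) (hYc : FaceConnected Y) {a c : Pt d} (ha : a ∈ X) (hc : c ∈ Y) (hac : Touch a c) :
    treeLen (Siter q 0 (X ∪ Y)) ≤ treeLen (Siter q 0 X) + treeLen (Siter q 0 Y) + 2 := by
  simpa using treeLen_union_le_of_touch' hX hXc hY hYc ha hc hac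

end Iterates

/-! ## Part 7. Lower bounds, and the counterexample to the UNPREMISED `hc` (`d = 1`) -/

section LowerBound

/-- TWO CUBES `m` APART COST LENGTH `m − 1`: if `x, y ∈ X` have `x_μ + m ≤ y_μ` (`m ≥ 2`), every admissible graph of `X`
has length ≥ `m − 1` (capture lemma `TreeLength.le_lenIn_closedBall`; generalises
`TreeLengthDichotomy.one_le_len_of_far`). [folklore] -/
theorem sub_one_le_len_of_apart {X : Finset (Pt d)} {T : List (Seg d)} (hT : Admissible X T) {x y : Pt d}
    (hx : x ∈ X) (hy : y ∈ X) {μ : Fin d} {m : ℕ} (hm : 2 ≤ m) (hfar : x μ + m ≤ y μ) : (m : ℝ) - 1 ≤ len T := by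
  obtain ⟨p, hpT, hpx⟩ := hT.meets x hx
  obtain ⟨q, hqT, hqy⟩ := hT.meets y hy
  have hp := (mem_cube.1 hpx μ).2
  have hq := (mem_cube.1 hqy μ).1
  have hc : ((x μ : ℤ) : ℝ) + m ≤ (y μ : ℝ) := by exact_mod_cast hfar
  have hm' : (2 : ℝ) ≤ m := by exact_mod_cast hm
  have hdist : (m : ℝ) - 1 ≤ dist p q := by
    refine le_trans ?_ (dist_le_pi_dist p q μ)
    rw [Real.dist_eq, abs_sub_comm, abs_of_nonneg (by linarith)]
    linarith
  calc (m : ℝ) - 1 ≤ lenIn (Metric.closedBall p ((m : ℝ) - 1)) T :=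
        le_lenIn_closedBall hT.connected.isPreconnected hpT hqT (by linarith) hdist
    _ ≤ len T := lenIn_le_len _ T

/-- Hence `d(X) ≥ m − 1` when two cubes of `X` are `m ≥ 2` apart in a coordinate and `X` has an admissible graph. [folklore] -/
theorem sub_one_le_treeLen_of_apart {X : Finset (Pt d)} (hne : ∃ T, Admissible X T) {x y : Pt d} (hx : x ∈ X)
    (hy : y ∈ X) {μ : Fin d} {m : ℕ} (hm : 2 ≤ m) (hfar : x μ + m ≤ y μ) : (m : ℝ) - 1 ≤ treeLen X :=
  le_treeLen hne fun _ hT => sub_one_le_len_of_apart hT hx hy hm hfar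

/-- SEPARATED PIECES HAVE NO ADMISSIBLE GRAPH: if no cube of `A ≠ ∅` touches a cube of `B ≠ ∅`, the index set `A ∪ B` has
no admissible graph, so its linear size takes the JUNK VALUE `0` (`TreeLengthDichotomy.treeLen_eq_zero_of_no_admissible`). [folklore] -/
theorem treeLen_union_eq_zero_of_separated {A B : Finset (Pt d)} (hA : A.Nonempty) (hB : B.Nonempty)
    (hsep : ∀ a ∈ A, ∀ c ∈ B, ¬ Touch a c) : treeLen (A ∪ B) = 0 := by
  refine treeLen_eq_zero_of_no_admissible ?_
  rintro ⟨T, hT⟩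
  obtain ⟨a, ha, c, hc, hac⟩ := exists_touch_of_admissible_union hA hB hT
  exact hsep a ha c hc hac

end LowerBound

namespace OneDim

/-- The cube of index `k` on the line (`d = 1`). [folklore] -/
def pt (k : ℤ) : Pt 1 := fun _ => k

/-- Coordinates of `pt k`. [folklore] -/
@[simp] theorem pt_apply (k : ℤ) (i : Fin 1) : pt k i = k := rfl

/-- THE ROW OF CUBES `a, a+1, …, a+n`. [folklore] -/
def row (a : ℤ) (n : ℕ) : Finset (Pt 1) := (Finset.range (n + 1)).image fun k : ℕ => pt (a + k)

/-- Membership in a row. [folklore] -/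
theorem mem_row {a : ℤ} {n : ℕ} {y : Pt 1} : y ∈ row a n ↔ ∃ k : ℕ, k ≤ n ∧ pt (a + k) = y := by
  constructor
  · intro h
    obtain ⟨k, hk, hky⟩ := Finset.mem_image.1 h
    exact ⟨k, Nat.lt_succ_iff.1 (Finset.mem_range.1 hk), hky⟩
  · rintro ⟨k, hk, hky⟩
    exact Finset.mem_image.2 ⟨k, Finset.mem_range.2 (Nat.lt_succ_iff.2 hk), hky⟩

/-- The cubes of a row. [folklore] -/
theorem pt_mem_row {a : ℤ} {n k : ℕ} (hk : k ≤ n) : pt (a + k) ∈ row a n := mem_row.2 ⟨k, hk, rfl⟩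

/-- A row is non-empty. [folklore] -/
theorem row_nonempty (a : ℤ) (n : ℕ) : (row a n).Nonempty := ⟨pt (a + (0 : ℕ)), pt_mem_row (Nat.zero_le n)⟩

/-- The coordinate range of a row. [folklore] -/
theorem coord_of_mem_row {a : ℤ} {n : ℕ} {y : Pt 1} (hy : y ∈ row a n) : a ≤ y 0 ∧ y 0 ≤ a + n := by
  obtain ⟨k, hk, rfl⟩ := mem_row.1 hy
  simp only [pt_apply]
  constructor <;> omega

/-- A one-cube row. [folklore] -/
theorem row_zero (a : ℤ) : row a 0 = {pt a} := by
  simp [row]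

/-- Consecutive cubes on the line have a common wall. [folklore] -/
theorem adj_pt_succ (m : ℤ) : Adj (pt m) (pt (m + 1)) := by
  refine ⟨0, Or.inl ?_⟩
  funext i
  have hi : i = 0 := Subsingleton.elim i 0
  subst hi
  simp [pt]

/-- Chains along a row. [folklore] -/
theorem linked_row (a : ℤ) (n : ℕ) :
    ∀ j : ℕ, j ≤ n → ∀ i : ℕ, i ≤ j → Linked (row a n) (pt (a + i)) (pt (a + j)) := by
  intro j
  induction j with
  | zero =>
    intro _ i hi
    obtain rfl : i = 0 := Nat.le_zero.1 hi
    exact Relation.ReflTransGen.refl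
  | succ j ih =>
    intro hj i hi
    rcases Nat.lt_or_eq_of_le hi with hlt | rfl
    · have h1 : Linked (row a n) (pt (a + i)) (pt (a + j)) :=
        ih (Nat.le_of_succ_le hj) i (Nat.lt_succ_iff.1 hlt)
      refine Relation.ReflTransGen.tail h1 ⟨pt_mem_row (Nat.le_of_succ_le hj), pt_mem_row hj, ?_⟩
      have : (a + ((j + 1 : ℕ) : ℤ)) = (a + j) + 1 := by push_cast; ring
      rw [this]
      exact adj_pt_succ (a + j)
    · exact Relation.ReflTransGen.refl

/-- A ROW IS FACE-CONNECTED (a localization domain). [folklore] -/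
theorem faceConnected_row (a : ℤ) (n : ℕ) : FaceConnected (row a n) := by
  intro x hx y hy
  obtain ⟨i, hi, rfl⟩ := mem_row.1 hx
  obtain ⟨j, hj, rfl⟩ := mem_row.1 hy
  rcases le_total i j with hij | hji
  · exact linked_row a n j hj i hij
  · exact (linked_row a n i hi j hji).symm

/-- A row has admissible graphs. [folklore] -/
theorem exists_admissible_row (a : ℤ) (n : ℕ) : ∃ T, Admissible (row a n) T := by
  obtain ⟨T, hT, -⟩ := exists_admissible (row_nonempty a n) (faceConnected_row a n)
  exact ⟨T, hT⟩

/-- Concatenation of rows: `{a..a+n} ∪ {a+n+1..a+n+1+m} = {a..a+n+m+1}`. [folklore] -/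
theorem row_union_row (a : ℤ) (n m : ℕ) : row a n ∪ row (a + n + 1) m = row a (n + m + 1) := by
  ext y
  rw [Finset.mem_union, mem_row, mem_row, mem_row]
  constructor
  · rintro (⟨k, hk, rfl⟩ | ⟨k, hk, rfl⟩)
    · exact ⟨k, by omega, rfl⟩
    · exact ⟨n + 1 + k, by omega, by congr 1; push_cast; ring⟩
  · rintro ⟨k, hk, rfl⟩
    by_cases hkn : k ≤ n
    · exact Or.inl ⟨k, hkn, rfl⟩
    · obtain ⟨k', rfl⟩ := Nat.exists_eq_add_of_le (show n + 1 ≤ k by omega)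
      exact Or.inr ⟨k', by omega, by congr 1; push_cast; ring⟩

/-- THE LENGTH OF A ROW FROM BELOW: `d({0, …, 2n+2}) ≥ 2n + 1`. [folklore] -/
theorem le_treeLen_row (n : ℕ) : (2 * n + 1 : ℝ) ≤ treeLen (row 0 (2 * n + 2)) := by
  have h := sub_one_le_treeLen_of_apart (exists_admissible_row 0 (2 * n + 2)) (x := pt (0 + ((0 : ℕ) : ℤ)))
    (y := pt (0 + ((2 * n + 2 : ℕ) : ℤ))) (pt_mem_row (Nat.zero_le _)) (pt_mem_row le_rfl) (μ := 0)
    (m := 2 * n + 2) (by omega) (by simp)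
  have e : (((2 * n + 2 : ℕ) : ℝ)) - 1 = 2 * n + 1 := by push_cast; ring
  rwa [e] at h

/-- THE THREE-PIECE FAMILY on the line: `P₀ = {0..n}`, `P₁ = {n+1}`, `P₂ = {n+2..2n+2}` — a "connected tree" of
domains (a path `P₀ ~ P₁ ~ P₂` in the touch graph) whose end pieces `P₀`, `P₂` are far apart. [folklore] -/
def P3 (n : ℕ) : Fin 3 → Finset (Pt 1) := ![row 0 n, row (n + 1) 0, row (n + 2) n]

/-- The first piece `{0..n}`. [folklore] -/
@[simp] theorem P3_zero (n : ℕ) : P3 n 0 = row 0 n := rfl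

/-- The middle piece `{n+1}`. [folklore] -/
@[simp] theorem P3_one (n : ℕ) : P3 n 1 = row (n + 1) 0 := rfl

/-- The last piece `{n+2..2n+2}`. [folklore] -/
@[simp] theorem P3_two (n : ℕ) : P3 n 2 = row (n + 2) n := rfl

/-- The whole family covers the row `{0..2n+2}`. [folklore] -/
theorem fam_P3_univ (n : ℕ) : fam (P3 n) Finset.univ = row 0 (2 * n + 2) := by
  have hu : (Finset.univ : Finset (Fin 3)) = {0, 1, 2} := by decide
  rw [hu, fam, Finset.biUnion_insert, Finset.biUnion_insert, Finset.singleton_biUnion, P3_zero, P3_one, P3_two]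
  have h1 : row ((n : ℤ) + 1) 0 ∪ row ((n : ℤ) + 2) n = row ((n : ℤ) + 1) (0 + n + 1) := by
    have := row_union_row ((n : ℤ) + 1) 0 n
    simpa [add_assoc, show ((1 : ℤ) + 1) = 2 by norm_num] using this
  have h2 : row 0 n ∪ row ((n : ℤ) + 1) (0 + n + 1) = row 0 (2 * n + 2) := by
    have := row_union_row 0 n (0 + n + 1)
    rw [zero_add] at this
    rw [this]
    congr 1
    omega
  rw [h1, h2]

/-- Removing the middle piece leaves the two separated rows. [folklore] -/
theorem fam_P3_erase (n : ℕ) : fam (P3 n) (Finset.univ.erase 1) = row 0 n ∪ row (n + 2) n := by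
  have hu : ((Finset.univ : Finset (Fin 3)).erase 1) = {0, 2} := by decide
  rw [hu, fam, Finset.biUnion_insert, Finset.singleton_biUnion, P3_zero, P3_two]

/-- The middle piece alone has linear size 0. [folklore] -/
theorem treeLen_fam_P3_one (n : ℕ) : treeLen (fam (P3 n) {1}) = 0 := by
  rw [fam_singleton, P3_one, row_zero]
  exact treeLen_singleton _

/-- The two separated rows have NO admissible graph: linear size = junk value 0. [folklore] -/
theorem treeLen_fam_P3_erase (n : ℕ) : treeLen (fam (P3 n) (Finset.univ.erase 1)) = 0 := by
  rw [fam_P3_erase]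
  refine treeLen_union_eq_zero_of_separated (row_nonempty _ _) (row_nonempty _ _) fun a ha c hc hac => ?_
  obtain ⟨-, ha2⟩ := coord_of_mem_row ha
  obtain ⟨hc1, -⟩ := coord_of_mem_row hc
  have := (hac 0).2
  omega

/-- THE UNPREMISED `hc` FAILS ON THE GEOMETRY.  The binder `hc : ∀ S x, x ∈ S → 2 ≤ S.card → cost S ≤ cost {x} + cost
(S ∖ {x}) + D` of `Step.Budget.merge_controls` (no connectivity premise on `S ∖ {x}`) is NOT inhabited by the cost
`S ↦ C·d(⋃ S)` (`C > 0`) uniformly in the family: for the three-piece family `P3 n` and the NON-LEAF middle piece, the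
left side is `≥ C(2n+1)` while `d` of the disconnected remainder is the junk value `0`.  (The Conn-premised binder of
`merge_controls_conn` IS inhabited: `merge_controls_treeLen`.) [folklore] -/
theorem unpremised_hc_fails {C : ℝ} (hC : 0 < C) (D : ℝ) : ∃ n : ℕ,
    ¬ ∀ (S : Finset (Fin 3)) (x : Fin 3), x ∈ S → 2 ≤ S.card →
      C * treeLen (fam (P3 n) S) ≤ C * treeLen (fam (P3 n) {x}) + C * treeLen (fam (P3 n) (S.erase x)) + D := by
  obtain ⟨n, hn⟩ := exists_nat_gt (D / C)
  have hD : D < C * (2 * n + 1) := by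
    have h1 : D < C * n := by
      have := (div_lt_iff₀ hC).1 hn
      linarith
    have h2 : C * n ≤ C * (2 * n + 1) := mul_le_mul_of_nonneg_left (by linarith [Nat.cast_nonneg (α := ℝ) n]) hC.le
    linarith
  refine ⟨n, fun h => ?_⟩
  have h1 := h Finset.univ 1 (Finset.mem_univ _) (by simp)
  rw [fam_P3_univ, treeLen_fam_P3_one, treeLen_fam_P3_erase] at h1
  have h2 := mul_le_mul_of_nonneg_left (le_treeLen_row n) hC.le
  linarith

end OneDim

/-! ## Part 8 (v2, APPEND-ONLY). «By (1.84) the graph G is connected» (p. 386): connectedness of the touch graph from a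
connected domain covered by the family — `STEP.md` §11 row O-F5 residual -/

section GraphConnected

/-- One step of a chain of cubes of the family `Z` whose consecutive cubes TOUCH (the closed unit cubes meet — weaker
than the common wall of `B13ScaleTransfer.StepIn`). [folklore] -/
def TouchStep (Z : Finset (Pt d)) (a b : Pt d) : Prop := a ∈ Z ∧ b ∈ Z ∧ Touch a b

/-- TOUCH-CHAIN CONNECTEDNESS of a family of cubes: every two cubes of `Z` are joined by a chain of cubes of `Z` whose
consecutive members touch (reflexive–transitive closure of `TouchStep Z`). [folklore] -/
def TouchConnected (Z : Finset (Pt d)) : Prop := ∀ x ∈ Z, ∀ y ∈ Z, Relation.ReflTransGen (TouchStep Z) x y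

/-- A face-connected family ([Balaban1987RG1] p. 257: chains with common walls, `B13ScaleTransfer.FaceConnected`) is
touch-connected (a common wall is a touch, `Touch.of_adj`). [folklore] -/
theorem touchConnected_of_faceConnected {Z : Finset (Pt d)} (h : FaceConnected Z) : TouchConnected Z := by
  intro x hx y hy
  have hl := h x hx y hy
  clear hx hy
  unfold Linked at hl
  induction hl with
  | refl => exact Relation.ReflTransGen.refl
  | tail _ hbc ih => exact Relation.ReflTransGen.tail ih ⟨hbc.1, hbc.2.1, Touch.of_adj hbc.2.2⟩

/-- A family of cubes with an ADMISSIBLE GRAPH (a connected graph inside its cubes meeting every cube — the carrier of the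
linear size `d_j`, `TreeLength.Admissible`) is touch-connected: the touch-chain class of a cube and its complement in
the family would otherwise be two non-empty subfamilies with no touching pair, contradicting
`exists_touch_of_admissible_union`. [folklore] -/
theorem touchConnected_of_admissible {Z : Finset (Pt d)} {T : List (Seg d)} (hT : Admissible Z T) :
    TouchConnected Z := by
  classical
  intro x hx y hy
  by_contra hxy
  set A : Finset (Pt d) := Z.filter (fun z => Relation.ReflTransGen (TouchStep Z) x z) with hA
  have hxA : x ∈ A := Finset.mem_filter.mpr ⟨hx, Relation.ReflTransGen.refl⟩
  have hyB : y ∈ Z \ A := Finset.mem_sdiff.mpr ⟨hy, fun h => hxy (Finset.mem_filter.mp h).2⟩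
  have hAZ : A ⊆ Z := Finset.filter_subset _ _
  have hunion : A ∪ (Z \ A) = Z := Finset.union_sdiff_of_subset hAZ
  have hT' : Admissible (A ∪ (Z \ A)) T := by rw [hunion]; exact hT
  obtain ⟨a, ha, c, hc, hac⟩ := exists_touch_of_admissible_union ⟨x, hxA⟩ ⟨y, hyB⟩ hT'
  have hxa : Relation.ReflTransGen (TouchStep Z) x a := (Finset.mem_filter.mp ha).2
  have hcZ : c ∈ Z := (Finset.mem_sdiff.mp hc).1
  have hxc : Relation.ReflTransGen (TouchStep Z) x c := hxa.tail ⟨hAZ ha, hcZ, hac⟩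
  exact (Finset.mem_sdiff.mp hc).2 (Finset.mem_filter.mpr ⟨hcZ, hxc⟩)

/-- A touch-connected family is face-connected OR NOT — touch-connectedness is strictly weaker (two cubes meeting at a
corner); recorded as the trivial direction only: a singleton is touch-connected. [folklore] -/
theorem touchConnected_singleton (x : Pt d) : TouchConnected ({x} : Finset (Pt d)) := by
  intro a ha b hb
  rw [Finset.mem_singleton] at ha hb
  subst ha; subst hb
  exact Relation.ReflTransGen.refl

variable {ι : Type*}

/-- Two members of a subfamily `S` whose domains own a touching pair of cubes are joined in the touch graph induced on
`S` (equal, or adjacent). [folklore] -/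
theorem reachable_induce_touchGraph_of_touch (P : ι → Finset (Pt d)) {S : Finset ι} (i j : ↥(S : Set ι))
    {a c : Pt d} (ha : a ∈ P i.1) (hc : c ∈ P j.1) (hac : Touch a c) :
    ((touchGraph P).induce (S : Set ι)).Reachable i j := by
  by_cases hij : i = j
  · subst hij
    exact SimpleGraph.Reachable.refl _
  · have hne : i.1 ≠ j.1 := fun h => hij (Subtype.ext h)
    exact SimpleGraph.Adj.reachable (SimpleGraph.induce_adj.2 ((touchGraph_adj P i.1 j.1).2 ⟨hne, a, ha, c, hc, hac⟩))

/-- «BY (1.84) THE GRAPH G IS CONNECTED» ([Balaban1989LargeFieldII] p. 386) in the index model: if a TOUCH-CONNECTED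
family of cubes `Z` is covered by the union of the domains of a non-empty subfamily `S` (print's (1.84):
*"Z ⊂ ⋃ₙ (Z_j^{(n)})′^{~10} ∪ ⋃ᵢ (Z_{j+1}^{(i)})^{~2}"*) and EVERY domain of the subfamily MEETS `Z` (the located implicit
premise: print's vertex domains are enlargements of the components *"joined together into the one component"* `Z`, p. 386,
so each contains cubes of `Z`; without it an extra far-away vertex disconnects `G`), then the touch graph (*"a pair of
domains is a line in G if … the corresponding domains intersect, or touch each other"*) induced on `S` is connected —
`Step.Budget.GConn (touchGraph P) S`, the connectedness premise of `Step.Budget.gconn_leaf` / `merge_controls_graph` and of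
`merge_controls_treeLen`.  Proof: walk a touch chain of `Z` between cubes of two given domains; consecutive cubes lie in
domains of `S` (cover) that are equal or adjacent in `G` (they own a touching pair).  Kernel-checked over the cell's
model; nothing printed is asserted. [cite: Balaban1989LargeFieldII, p.386 (merge step, (1.84)-(1.87))] -/
theorem gconn_touchGraph_of_touchConnected (P : ι → Finset (Pt d)) {S : Finset ι} {Z : Finset (Pt d)}
    (hZ : TouchConnected Z) (hZS : Z ⊆ fam P S) (hmeet : ∀ i ∈ S, ∃ z ∈ Z, z ∈ P i) (hS : S.Nonempty) :
    GConn (touchGraph P) S := by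
  classical
  unfold GConn
  obtain ⟨i₀, hi₀⟩ := hS
  haveI : Nonempty ↥(S : Set ι) := ⟨⟨i₀, Finset.mem_coe.mpr hi₀⟩⟩
  refine SimpleGraph.Connected.mk fun u v => ?_
  obtain ⟨zu, hzuZ, hzuP⟩ := hmeet u.1 (Finset.mem_coe.mp u.2)
  obtain ⟨zv, hzvZ, hzvP⟩ := hmeet v.1 (Finset.mem_coe.mp v.2)
  have key : ∀ w, Relation.ReflTransGen (TouchStep Z) zu w → ∀ j : ↥(S : Set ι), w ∈ P j.1 →
      ((touchGraph P).induce (S : Set ι)).Reachable u j := by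
    intro w hw
    induction hw with
    | refl =>
      intro j hwj
      exact reachable_induce_touchGraph_of_touch P u j hzuP hwj (Touch.refl zu)
    | tail _ hbc ih =>
      intro j hcj
      obtain ⟨k, hk, hbk⟩ := mem_fam.mp (hZS hbc.1)
      exact (ih ⟨k, Finset.mem_coe.mpr hk⟩ hbk).trans
        (reachable_induce_touchGraph_of_touch P ⟨k, Finset.mem_coe.mpr hk⟩ j hbk hcj hbc.2.2)
  exact key zv (hZ zu hzuZ zv hzvZ) v hzvP

/-- The same with `Z` FACE-CONNECTED (a localization domain in the sense of [Balaban1987RG1] p. 257).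
[cite: Balaban1989LargeFieldII, p.386 (merge step, (1.84)-(1.87))] -/
theorem gconn_touchGraph_of_faceConnected (P : ι → Finset (Pt d)) {S : Finset ι} {Z : Finset (Pt d)}
    (hZ : FaceConnected Z) (hZS : Z ⊆ fam P S) (hmeet : ∀ i ∈ S, ∃ z ∈ Z, z ∈ P i) (hS : S.Nonempty) :
    GConn (touchGraph P) S :=
  gconn_touchGraph_of_touchConnected P (touchConnected_of_faceConnected hZ) hZS hmeet hS

/-- The same with `Z` carrying an ADMISSIBLE GRAPH (the `d_j`-carrier notion of connectedness).
[cite: Balaban1989LargeFieldII, p.386 (merge step, (1.84)-(1.87))] -/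
theorem gconn_touchGraph_of_admissible (P : ι → Finset (Pt d)) {S : Finset ι} {Z : Finset (Pt d)} {T : List (Seg d)}
    (hT : Admissible Z T) (hZS : Z ⊆ fam P S) (hmeet : ∀ i ∈ S, ∃ z ∈ Z, z ∈ P i) (hS : S.Nonempty) :
    GConn (touchGraph P) S :=
  gconn_touchGraph_of_touchConnected P (touchConnected_of_admissible hT) hZS hmeet hS

/-- THE PREMISE «every domain meets Z» CANNOT BE DROPPED: in `d = 1` the two far-apart singleton domains `{0}` and `{5}`
cover `Z = {0}` (face-connected), yet their touch graph on both indices is disconnected. [folklore] -/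
theorem not_gconn_without_meet :
    ∃ (P : Fin 2 → Finset (Pt 1)) (Z : Finset (Pt 1)), FaceConnected Z ∧ Z ⊆ fam P Finset.univ ∧
      ¬ GConn (touchGraph P) Finset.univ := by
  classical
  refine ⟨![{fun _ => 0}, {fun _ => 5}], {fun _ => 0}, ?_, ?_, ?_⟩
  · intro x hx y hy
    rw [Finset.mem_singleton] at hx hy
    subst hx; subst hy
    exact Relation.ReflTransGen.refl
  · intro z hz
    exact mem_fam.mpr ⟨0, Finset.mem_univ _, by simpa using hz⟩
  · intro h
    have h2 : 2 ≤ (Finset.univ : Finset (Fin 2)).card := by simp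
    obtain ⟨y, hy, hadj⟩ := gconn_adj (touchGraph ![{fun _ => 0}, {fun _ => 5}]) Finset.univ h h2
      (Finset.mem_univ (0 : Fin 2))
    obtain ⟨hne, a, ha, c, hc, hac⟩ := (touchGraph_adj _ _ _).1 hadj
    have key : ∀ y' : Fin 2, y' ∈ (Finset.univ : Finset (Fin 2)).erase 0 → y' = 1 := by decide
    have hy1 : y = 1 := key y hy
    subst hy1
    simp only [Matrix.cons_val_zero, Matrix.cons_val_one, Finset.mem_singleton] at ha hc
    subst ha; subst hc
    have h5 := (hac 0).2
    norm_num at h5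

end GraphConnected

end

end Literature.MathematicalPhysics.QuantumFieldTheory.Balaban1983to89.B16MergeGeometry
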